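import Literature.Barriers.FinalStateConjecture.GregoryLaflammeInstabilityProofs
import Literature.Analysis.ODE.SchrodingerBoundState
import Mathlib.Analysis.SpecialFunctions.Log.Deriv
import Mathlib.MeasureTheory.Function.JacobianOneDim
import HarnessLib

/-!
# Proof of the variational principle behind the Gregory–Laflamme instability

Topic `Literature/Barriers/FinalStateConjecture` (namespace `Literature.Barriers.FinalStateConjecture`).
This file DISCHARGES the named fact
`Literature.Barriers.FinalStateConjecture.GregoryLaflammeNegativeEigenfunction` of
`GregoryLaflammeSchrodinger.lean` — Collingbourne's variational principle (J. Math. Phys. 62 (2021)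
032502 = arXiv:2007.08441, Prop. 4.3 with Cor. 4.4, the Euler–Lagrange step and the regularity
Theorem 8.3, as combined in the proof of Prop. 4.6, p. 22): a `C¹` test function of finite
`H¹(ℝ)`-norm whose energy lies below `E' ‖ψ‖²` with `E' < 0` forces a smooth `H¹` solution `u ≢ 0`
of the Schrödinger equation (ODEF) with spectral parameter `E ≤ E'` — and with it (given
Prop. 4.5, `GregoryLaflammeTestEnergyBound`) the barrier fact `GregoryLaflammeInstability`.

The source runs the direct method of the calculus of variations in `H¹(ℝ)` (minimising sequence,
Rellich compactness, weak lower semicontinuity, Euler–Lagrange, elliptic regularity). We prove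
the same statement by the classical ODE route of `Literature.Analysis.ODE.exists_boundState_of_rayleigh`
(Sturm–Picone shooting on `[-R, R]`, `R → ∞`; Hartman, *Ordinary Differential Equations*, Ch. XI §6),
after passing to the tortoise variable `s = x_* = x + log (x - 1)` of §4.1 of the source, in which
(ODEF) is literally `-u'' + V u = E u` on `ℝ` and the `H¹`/energy/`L²` densities of pp. 20–21
become `u'² + u²`, `u'² + V u²`, `u²` (change of variables `dx_*/dx = x/(x-1)`):

* `glTortoise`, `glTortoiseInv` — the tortoise coordinate `T(x) = x + log(x-1)` on `(1, ∞)` and its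
  inverse `X : ℝ → (1, ∞)` (`T` is expanding, so `X` is `1`-Lipschitz; `X' = (X-1)/X`).
* `abs_glPotential_le`, `abs_glPotential_le_mul`, `glPotential_ge` — elementary bounds for the
  Gregory–Laflamme potential: `|V| ≤ ω̂² + 89`, `|V| ≤ (ω̂² + 89)(x - 1)`, `V ≥ -71/x²` on `x > 1`
  (so `V → 0` at the horizon and `lim inf V ≥ 0` at infinity, Cor. 4.4).
* `GregoryLaflammeNegativeEigenfunction_holds` — the discharge; `GregoryLaflammeInstability_holds` — the
  barrier fact itself (with `GregoryLaflammeTestEnergyBound_holds` of `GregoryLaflammeInstabilityProofs.lean`).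

## References

* S. C. Collingbourne, J. Math. Phys. 62 (2021) 032502 = arXiv:2007.08441: §4.1 (eqs. (HZX),
  (ODEF), (pot); `x_* = x + log|x - 1|`), Prop. 4.3, Cor. 4.4, §4.3 (pp. 20–21, the densities in the
  `x`-variable), Prop. 4.6 and its proof (p. 22), Thm. 8.3. Key `Collingbourne2021`.
* P. Hartman, *Ordinary Differential Equations* (SIAM 2002), Ch. XI §6. Key `Hartman2002`.
-/

noncomputable section

open Set Filter MeasureTheory
open scoped Topology

namespace Literature.Barriers.FinalStateConjecture

open Literature.Analysis.ODE

/-! ## The tortoise coordinate -/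

/-- The (dimensionless) tortoise coordinate `x_* = x + log (x - 1)` of the Schwarzschild black
string exterior, `x = r/2M ∈ (1, ∞)` (Collingbourne §4.1: "`x_* = r_*/2M = x + log|x - 1|`").
[cite: Collingbourne2021, §4.1] -/
def glTortoise (x : ℝ) : ℝ := x + Real.log (x - 1)

/-- `dx_*/dx = 1 + 1/(x-1) = x/(x-1)` on `x > 1`. [cite: Collingbourne2021, §4.1] -/
theorem hasDerivAt_glTortoise {x : ℝ} (hx : 1 < x) : HasDerivAt glTortoise (x / (x - 1)) x := by
  have hx1 : x - 1 ≠ 0 := by linarith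
  have h := (hasDerivAt_id' x).add (((hasDerivAt_id' x).sub_const 1).log hx1)
  refine h.congr_deriv ?_
  field_simp
  ring

/-- The tortoise map is expanding: `T y - T x ≥ y - x` for `1 < x ≤ y`. [folklore] -/
theorem sub_le_glTortoise_sub {x y : ℝ} (hx : 1 < x) (hxy : x ≤ y) : y - x ≤ glTortoise y - glTortoise x := by
  have := Real.log_le_log (by linarith) (by linarith : x - 1 ≤ y - 1)
  simp only [glTortoise]
  linarith

/-- The tortoise map is strictly increasing on `(1, ∞)`. [folklore] -/
theorem strictMonoOn_glTortoise : StrictMonoOn glTortoise (Ioi 1) := fun x hx y _ hxy => by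
  have := sub_le_glTortoise_sub hx hxy.le
  linarith

/-- `|x - y| ≤ |T x - T y|` on `(1, ∞)`. [folklore] -/
theorem abs_sub_le_abs_glTortoise_sub {x y : ℝ} (hx : 1 < x) (hy : 1 < y) :
    |x - y| ≤ |glTortoise x - glTortoise y| := by
  rcases le_total x y with h | h
  · rw [abs_sub_comm, abs_sub_comm (glTortoise x), abs_of_nonneg (by linarith),
      abs_of_nonneg (by linarith [sub_le_glTortoise_sub hx h])]
    exact sub_le_glTortoise_sub hx h
  · rw [abs_of_nonneg (by linarith), abs_of_nonneg (by linarith [sub_le_glTortoise_sub hy h])]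
    exact sub_le_glTortoise_sub hy h

/-- A point below level `s`: `T (1 + e^{-(|s|+2)}) < s`. [folklore] -/
theorem tortoise_low_lt (s : ℝ) : glTortoise (1 + Real.exp (-(|s| + 2))) < s := by
  simp only [glTortoise, add_sub_cancel_left, Real.log_exp]
  have h1 : Real.exp (-(|s| + 2)) < 1 := by
    rw [← Real.exp_zero]
    exact Real.exp_lt_exp.2 (by linarith [abs_nonneg s])
  linarith [neg_abs_le s]

/-- A point above level `s`: `s < T (|s| + 2)`. [folklore] -/
theorem lt_glTortoise_high (s : ℝ) : s < glTortoise (|s| + 2) := by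
  simp only [glTortoise]
  have h1 : 0 ≤ Real.log (|s| + 2 - 1) := Real.log_nonneg (by linarith [abs_nonneg s])
  linarith [le_abs_self s]

/-- `T` maps `(1, ∞)` onto `ℝ` (intermediate value theorem between the two points above).
[folklore] -/
theorem exists_glTortoise_eq (s : ℝ) : ∃ x ∈ Ioi (1 : ℝ), glTortoise x = s := by
  set a : ℝ := 1 + Real.exp (-(|s| + 2)) with ha
  set b : ℝ := |s| + 2 with hb
  have ha1 : 1 < a := by rw [ha]; linarith [Real.exp_pos (-(|s| + 2))]
  have hab : a ≤ b := by
    rw [ha, hb]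
    have : Real.exp (-(|s| + 2)) ≤ 1 := by
      rw [← Real.exp_zero]; exact Real.exp_le_exp.2 (by linarith [abs_nonneg s])
    linarith [abs_nonneg s]
  have hcont : ContinuousOn glTortoise (Icc a b) := fun x hx =>
    (hasDerivAt_glTortoise (lt_of_lt_of_le ha1 hx.1)).continuousAt.continuousWithinAt
  obtain ⟨x, hx, hxs⟩ := intermediate_value_Icc hab hcont
    ⟨(tortoise_low_lt s).le, (lt_glTortoise_high s).le⟩
  exact ⟨x, lt_of_lt_of_le ha1 hx.1, hxs⟩

/-- **The inverse tortoise map** `X : ℝ → (1, ∞)`, `T (X s) = s` ("`x` is understood as an implicit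
function of `x_*`", Collingbourne §4.1). [cite: Collingbourne2021, §4.1] -/
def glTortoiseInv (s : ℝ) : ℝ := Classical.choose (exists_glTortoise_eq s)

/-- `X s > 1`. [folklore] -/
theorem one_lt_glTortoiseInv (s : ℝ) : 1 < glTortoiseInv s :=
  (Classical.choose_spec (exists_glTortoise_eq s)).1

/-- `T (X s) = s`. [folklore] -/
theorem tortoise_glTortoiseInv (s : ℝ) : glTortoise (glTortoiseInv s) = s :=
  (Classical.choose_spec (exists_glTortoise_eq s)).2

/-- `X (T x) = x` for `x > 1`. [folklore] -/
theorem glTortoiseInv_glTortoise {x : ℝ} (hx : 1 < x) : glTortoiseInv (glTortoise x) = x :=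
  strictMonoOn_glTortoise.injOn (one_lt_glTortoiseInv _) hx (tortoise_glTortoiseInv _)

/-- `X` is `1`-Lipschitz (because `T` is expanding). [folklore] -/
theorem lipschitzWith_glTortoiseInv : LipschitzWith 1 glTortoiseInv :=
  LipschitzWith.of_dist_le_mul fun s t => by
    rw [NNReal.coe_one, one_mul, Real.dist_eq, Real.dist_eq]
    have h := abs_sub_le_abs_glTortoise_sub (one_lt_glTortoiseInv s) (one_lt_glTortoiseInv t)
    rwa [tortoise_glTortoiseInv, tortoise_glTortoiseInv] at h

/-- `X` is continuous. [folklore] -/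
theorem continuous_glTortoiseInv : Continuous glTortoiseInv := lipschitzWith_glTortoiseInv.continuous

/-- `dX/ds = (X - 1)/X` (inverse function rule). [cite: Collingbourne2021, §4.1] -/
theorem hasDerivAt_glTortoiseInv (s : ℝ) :
    HasDerivAt glTortoiseInv ((glTortoiseInv s - 1) / glTortoiseInv s) s := by
  have hx := one_lt_glTortoiseInv s
  have h := HasDerivAt.of_local_left_inverse continuous_glTortoiseInv.continuousAt
    (hasDerivAt_glTortoise hx) (div_pos (by linarith) (by linarith)).ne'
    (Eventually.of_forall tortoise_glTortoiseInv)
  rwa [inv_div] at h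

/-- `deriv X s = (X s - 1)/X s`. [folklore] -/
theorem deriv_glTortoiseInv (s : ℝ) : deriv glTortoiseInv s = (glTortoiseInv s - 1) / glTortoiseInv s :=
  (hasDerivAt_glTortoiseInv s).deriv

/-- `X` is of class `C¹`. [folklore] -/
theorem contDiff_glTortoiseInv : ContDiff ℝ 1 glTortoiseInv := by
  rw [contDiff_one_iff_deriv]
  refine ⟨fun s => (hasDerivAt_glTortoiseInv s).differentiableAt, ?_⟩
  have : deriv glTortoiseInv = fun s => (glTortoiseInv s - 1) / glTortoiseInv s := funext deriv_glTortoiseInv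
  rw [this]
  exact (continuous_glTortoiseInv.sub continuous_const).div continuous_glTortoiseInv
    fun s => (lt_trans zero_lt_one (one_lt_glTortoiseInv s)).ne'

/-- `X` is monotone: `T x ≤ s → x ≤ X s` for `x > 1`. [folklore] -/
theorem le_glTortoiseInv_of_glTortoise_le {x s : ℝ} (hx : 1 < x) (h : glTortoise x ≤ s) : x ≤ glTortoiseInv s := by
  by_contra hlt
  push Not at hlt
  have := strictMonoOn_glTortoise (one_lt_glTortoiseInv s) hx hlt
  rw [tortoise_glTortoiseInv] at this
  linarith

/-- `X` is monotone: `s ≤ T x → X s ≤ x` for `x > 1`. [folklore] -/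
theorem glTortoiseInv_le_of_le_glTortoise {x s : ℝ} (hx : 1 < x) (h : s ≤ glTortoise x) : glTortoiseInv s ≤ x := by
  by_contra hlt
  push Not at hlt
  have := strictMonoOn_glTortoise hx (one_lt_glTortoiseInv s) hlt
  rw [tortoise_glTortoiseInv] at this
  linarith

/-- The image of `(1, ∞)` under `T` is all of `ℝ`. [folklore] -/
theorem image_glTortoise_Ioi : glTortoise '' Ioi 1 = univ :=
  eq_univ_of_forall fun s => ⟨glTortoiseInv s, one_lt_glTortoiseInv s, tortoise_glTortoiseInv s⟩

/-! ## Elementary bounds for the Gregory–Laflamme potential -/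

/-- The four terms of `V`, bounded on `x > 1`: `0 ≤ ω̂²(x-1)/x ≤ ω̂² (x - 1)` and `≤ ω̂²`. [folklore] -/
theorem glPotential_term1_bounds (ω : ℝ) {x : ℝ} (hx : 1 < x) :
    0 ≤ ω ^ 2 * (x - 1) / x ∧ ω ^ 2 * (x - 1) / x ≤ ω ^ 2 * (x - 1) ∧ ω ^ 2 * (x - 1) / x ≤ ω ^ 2 := by
  have hx0 : 0 < x := by linarith
  have h0 : 0 ≤ ω ^ 2 * (x - 1) := mul_nonneg (sq_nonneg ω) (by linarith)
  refine ⟨by positivity, ?_, ?_⟩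
  · rw [div_le_iff₀ hx0]; nlinarith [mul_nonneg h0 (by linarith : (0:ℝ) ≤ x - 1)]
  · rw [div_le_iff₀ hx0]; nlinarith [mul_nonneg (sq_nonneg ω) (by linarith : (0:ℝ) ≤ x - 1)]

/-- `|(6x-11)(x-1)/x⁴| ≤ 17 (x-1)/x³` on `x > 1`. [folklore] -/
theorem glPotential_term2_bound {x : ℝ} (hx : 1 < x) :
    |(6 * x - 11) * (x - 1) / x ^ 4| ≤ 17 * (x - 1) / x ^ 3 := by
  have hx0 : 0 < x := by linarith
  have h4 : 0 < x ^ 4 := by positivity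
  rw [abs_div, abs_of_pos h4, div_le_div_iff₀ h4 (by positivity), abs_mul, abs_of_pos (by linarith : 0 < x - 1)]
  have h1 : |6 * x - 11| ≤ 17 * x := by
    rw [abs_le]; constructor <;> linarith
  have h2 : 0 ≤ (x - 1) * x ^ 3 := by positivity
  calc |6 * x - 11| * (x - 1) * x ^ 3 = |6 * x - 11| * ((x - 1) * x ^ 3) := by ring
    _ ≤ 17 * x * ((x - 1) * x ^ 3) := mul_le_mul_of_nonneg_right h1 h2
    _ = 17 * (x - 1) * x ^ 4 := by ring

/-- `0 ≤ 18(x-1)²/(x⁴(1+ω̂²x³)²) ≤ 18 (x-1)²/x⁴` on `x > 1`. [folklore] -/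
theorem glPotential_term3_bounds (ω : ℝ) {x : ℝ} (hx : 1 < x) :
    0 ≤ 18 * (x - 1) ^ 2 / (x ^ 4 * (1 + ω ^ 2 * x ^ 3) ^ 2) ∧
      18 * (x - 1) ^ 2 / (x ^ 4 * (1 + ω ^ 2 * x ^ 3) ^ 2) ≤ 18 * (x - 1) ^ 2 / x ^ 4 := by
  have hx0 : 0 < x := by linarith
  have hden : 1 ≤ (1 + ω ^ 2 * x ^ 3) ^ 2 := by
    have : 1 ≤ 1 + ω ^ 2 * x ^ 3 := by nlinarith [sq_nonneg ω, pow_pos hx0 3]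
    nlinarith
  refine ⟨by positivity, ?_⟩
  rw [div_le_div_iff₀ (by positivity) (by positivity)]
  have h0 : 0 ≤ 18 * (x - 1) ^ 2 * x ^ 4 := by positivity
  nlinarith

/-- `|6(4x-5)(x-1)/(x⁴(1+ω̂²x³))| ≤ 54 (x-1)/x³` on `x > 1`. [folklore] -/
theorem glPotential_term4_bound (ω : ℝ) {x : ℝ} (hx : 1 < x) :
    |6 * (4 * x - 5) * (x - 1) / (x ^ 4 * (1 + ω ^ 2 * x ^ 3))| ≤ 54 * (x - 1) / x ^ 3 := by
  have hx0 : 0 < x := by linarith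
  have hden1 : 1 ≤ 1 + ω ^ 2 * x ^ 3 := by nlinarith [sq_nonneg ω, pow_pos hx0 3]
  have hden : 0 < x ^ 4 * (1 + ω ^ 2 * x ^ 3) := by positivity
  rw [abs_div, abs_of_pos hden, div_le_div_iff₀ hden (by positivity)]
  have h1 : |6 * (4 * x - 5) * (x - 1)| ≤ 54 * x * (x - 1) := by
    rw [abs_mul, abs_mul, abs_of_pos (by linarith : 0 < x - 1), abs_of_pos (by norm_num : (0:ℝ) < 6)]
    have : |4 * x - 5| ≤ 9 * x := by rw [abs_le]; constructor <;> linarith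
    nlinarith
  calc |6 * (4 * x - 5) * (x - 1)| * x ^ 3 ≤ 54 * x * (x - 1) * x ^ 3 :=
        mul_le_mul_of_nonneg_right h1 (by positivity)
    _ = 54 * (x - 1) * (x ^ 4 * 1) := by ring
    _ ≤ 54 * (x - 1) * (x ^ 4 * (1 + ω ^ 2 * x ^ 3)) := by
        apply mul_le_mul_of_nonneg_left _ (by nlinarith)
        exact mul_le_mul_of_nonneg_left hden1 (by positivity)

/-- **`V` vanishes linearly at the horizon**: `|V x| ≤ (ω̂² + 89)(x - 1)` for `x > 1` (each term of
(pot) carries a factor `x - 1`; Cor. 4.4: "`q` satisfies `lim_{|x_*|→∞} q(x_*) = 0`" at the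
horizon end, and `p = ω̂²(x-1)/x → 0`). [cite: Collingbourne2021, Cor. 4.4] -/
theorem abs_glPotential_le_mul (ω : ℝ) {x : ℝ} (hx : 1 < x) :
    |glPotential ω x| ≤ (ω ^ 2 + 89) * (x - 1) := by
  have hx0 : 0 < x := by linarith
  obtain ⟨h1a, h1b, -⟩ := glPotential_term1_bounds ω hx
  have h2 := glPotential_term2_bound hx
  obtain ⟨h3a, h3b⟩ := glPotential_term3_bounds ω hx
  have h4 := glPotential_term4_bound ω hx
  have hx3 : 1 ≤ x ^ 3 := one_le_pow₀ hx.le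
  have hx4 : 1 ≤ x ^ 4 := one_le_pow₀ hx.le
  have h2' : 17 * (x - 1) / x ^ 3 ≤ 17 * (x - 1) := div_le_self (by nlinarith) hx3
  have h3' : 18 * (x - 1) ^ 2 / x ^ 4 ≤ 18 * (x - 1) := by
    rw [div_le_iff₀ (by positivity)]
    nlinarith [mul_le_mul_of_nonneg_left hx4 (by linarith : 0 ≤ x - 1)]
  have h4' : 54 * (x - 1) / x ^ 3 ≤ 54 * (x - 1) := div_le_self (by nlinarith) hx3
  unfold glPotential
  calc _ ≤ |ω ^ 2 * (x - 1) / x + (6 * x - 11) * (x - 1) / x ^ 4 +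
          18 * (x - 1) ^ 2 / (x ^ 4 * (1 + ω ^ 2 * x ^ 3) ^ 2)| +
        |6 * (4 * x - 5) * (x - 1) / (x ^ 4 * (1 + ω ^ 2 * x ^ 3))| := abs_sub _ _
    _ ≤ |ω ^ 2 * (x - 1) / x + (6 * x - 11) * (x - 1) / x ^ 4| +
          |18 * (x - 1) ^ 2 / (x ^ 4 * (1 + ω ^ 2 * x ^ 3) ^ 2)| +
        |6 * (4 * x - 5) * (x - 1) / (x ^ 4 * (1 + ω ^ 2 * x ^ 3))| := by
        gcongr; exact abs_add_le _ _
    _ ≤ |ω ^ 2 * (x - 1) / x| + |(6 * x - 11) * (x - 1) / x ^ 4| +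
          |18 * (x - 1) ^ 2 / (x ^ 4 * (1 + ω ^ 2 * x ^ 3) ^ 2)| +
        |6 * (4 * x - 5) * (x - 1) / (x ^ 4 * (1 + ω ^ 2 * x ^ 3))| := by
        gcongr; exact abs_add_le _ _
    _ ≤ ω ^ 2 * (x - 1) + 17 * (x - 1) + 18 * (x - 1) + 54 * (x - 1) := by
        rw [abs_of_nonneg h1a, abs_of_nonneg h3a]
        linarith
    _ = (ω ^ 2 + 89) * (x - 1) := by ring

/-- **`V` is bounded**: `|V x| ≤ ω̂² + 89` for `x > 1` (Cor. 4.4: `p = ω̂²(x-1)/x` is bounded — the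
source prints "`sup |p(x_*)| = 1`", a slip for `ω̂²`; the bound here uses `ω̂²` — and `q` is bounded).
[cite: Collingbourne2021, Cor. 4.4] -/
theorem abs_glPotential_le (ω : ℝ) {x : ℝ} (hx : 1 < x) : |glPotential ω x| ≤ ω ^ 2 + 89 := by
  have hx0 : 0 < x := by linarith
  obtain ⟨h1a, -, h1c⟩ := glPotential_term1_bounds ω hx
  have h2 := glPotential_term2_bound hx
  obtain ⟨h3a, h3b⟩ := glPotential_term3_bounds ω hx
  have h4 := glPotential_term4_bound ω hx
  have hx3 : x - 1 ≤ x ^ 3 := by nlinarith [one_le_pow₀ (n := 2) hx.le]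
  have h2' : 17 * (x - 1) / x ^ 3 ≤ 17 := by
    rw [div_le_iff₀ (by positivity)]; nlinarith
  have h3' : 18 * (x - 1) ^ 2 / x ^ 4 ≤ 18 := by
    rw [div_le_iff₀ (by positivity)]
    have : (x - 1) ^ 2 ≤ x ^ 4 := by nlinarith [one_le_pow₀ (n := 2) hx.le, sq_nonneg (x - 1)]
    nlinarith
  have h4' : 54 * (x - 1) / x ^ 3 ≤ 54 := by
    rw [div_le_iff₀ (by positivity)]; nlinarith
  unfold glPotential
  calc _ ≤ |ω ^ 2 * (x - 1) / x + (6 * x - 11) * (x - 1) / x ^ 4 +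
          18 * (x - 1) ^ 2 / (x ^ 4 * (1 + ω ^ 2 * x ^ 3) ^ 2)| +
        |6 * (4 * x - 5) * (x - 1) / (x ^ 4 * (1 + ω ^ 2 * x ^ 3))| := abs_sub _ _
    _ ≤ |ω ^ 2 * (x - 1) / x + (6 * x - 11) * (x - 1) / x ^ 4| +
          |18 * (x - 1) ^ 2 / (x ^ 4 * (1 + ω ^ 2 * x ^ 3) ^ 2)| +
        |6 * (4 * x - 5) * (x - 1) / (x ^ 4 * (1 + ω ^ 2 * x ^ 3))| := by
        gcongr; exact abs_add_le _ _
    _ ≤ |ω ^ 2 * (x - 1) / x| + |(6 * x - 11) * (x - 1) / x ^ 4| +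
          |18 * (x - 1) ^ 2 / (x ^ 4 * (1 + ω ^ 2 * x ^ 3) ^ 2)| +
        |6 * (4 * x - 5) * (x - 1) / (x ^ 4 * (1 + ω ^ 2 * x ^ 3))| := by
        gcongr; exact abs_add_le _ _
    _ ≤ ω ^ 2 + 17 + 18 + 54 := by
        rw [abs_of_nonneg h1a, abs_of_nonneg h3a]
        linarith
    _ = ω ^ 2 + 89 := by ring

/-- **`V` is asymptotically nonnegative at infinity**: `V x ≥ -71/x²` for `x > 1` (the terms
`ω̂²(x-1)/x` and `18(x-1)²/(x⁴(1+ω̂²x³)²)` are `≥ 0`; "`V` tends to the constant `ω̂²` at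
spatial infinity", §4.1). [cite: Collingbourne2021, §4.1] -/
theorem glPotential_ge (ω : ℝ) {x : ℝ} (hx : 1 < x) : -(71 / x ^ 2) ≤ glPotential ω x := by
  have hx0 : 0 < x := by linarith
  obtain ⟨h1a, -, -⟩ := glPotential_term1_bounds ω hx
  have h2 := glPotential_term2_bound hx
  obtain ⟨h3a, -⟩ := glPotential_term3_bounds ω hx
  have h4 := glPotential_term4_bound ω hx
  have hk : (x - 1) / x ^ 3 ≤ 1 / x ^ 2 := by
    rw [div_le_div_iff₀ (by positivity) (by positivity)]; nlinarith
  have h2' : -(17 / x ^ 2) ≤ (6 * x - 11) * (x - 1) / x ^ 4 := by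
    have := neg_abs_le ((6 * x - 11) * (x - 1) / x ^ 4)
    have : 17 * (x - 1) / x ^ 3 ≤ 17 / x ^ 2 :=
      calc 17 * (x - 1) / x ^ 3 = 17 * ((x - 1) / x ^ 3) := by ring
        _ ≤ 17 * (1 / x ^ 2) := mul_le_mul_of_nonneg_left hk (by norm_num)
        _ = 17 / x ^ 2 := by ring
    linarith
  have h4' : 6 * (4 * x - 5) * (x - 1) / (x ^ 4 * (1 + ω ^ 2 * x ^ 3)) ≤ 54 / x ^ 2 := by
    have := le_abs_self (6 * (4 * x - 5) * (x - 1) / (x ^ 4 * (1 + ω ^ 2 * x ^ 3)))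
    have : 54 * (x - 1) / x ^ 3 ≤ 54 / x ^ 2 :=
      calc 54 * (x - 1) / x ^ 3 = 54 * ((x - 1) / x ^ 3) := by ring
        _ ≤ 54 * (1 / x ^ 2) := mul_le_mul_of_nonneg_left hk (by norm_num)
        _ = 54 / x ^ 2 := by ring
    linarith
  unfold glPotential
  have : -(71 / x ^ 2) = 0 + -(17 / x ^ 2) + 0 - 54 / x ^ 2 := by ring
  rw [this]
  gcongr

/-! ## Change of variables between `x ∈ (1, ∞)` and `s = x_* ∈ ℝ` -/

/-- **Change of variables** `s = x_*`: for every `g : ℝ → ℝ`,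
`∫_ℝ g(s) ds = ∫₁^∞ (x/(x-1)) g(T x) dx` (no integrability needed; Collingbourne p. 20: "where on
the right-hand side the change of variables from `x_* ∈ ℝ` to `x ∈ (1, ∞)` has been made").
[cite: Collingbourne2021, §4.3 p. 20] -/
theorem integral_comp_glTortoise (g : ℝ → ℝ) :
    ∫ s, g s = ∫ x in Ioi 1, x / (x - 1) * g (glTortoise x) := by
  have h := integral_image_eq_integral_abs_deriv_smul measurableSet_Ioi
    (fun x hx => (hasDerivAt_glTortoise hx).hasDerivWithinAt) strictMonoOn_glTortoise.injOn g
  rw [image_glTortoise_Ioi, Measure.restrict_univ] at h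
  rw [h]
  refine setIntegral_congr_fun measurableSet_Ioi fun x hx => ?_
  have hx1 : (1 : ℝ) < x := hx
  rw [smul_eq_mul, abs_of_pos (div_pos (by linarith) (by linarith))]

/-- `g` is integrable on `ℝ` iff `x ↦ (x/(x-1)) g (T x)` is integrable on `(1, ∞)`. [folklore] -/
theorem integrable_iff_comp_glTortoise (g : ℝ → ℝ) :
    Integrable g ↔ IntegrableOn (fun x => x / (x - 1) * g (glTortoise x)) (Ioi 1) := by
  have h := integrableOn_image_iff_integrableOn_abs_deriv_smul measurableSet_Ioi
    (fun x hx => (hasDerivAt_glTortoise hx).hasDerivWithinAt) strictMonoOn_glTortoise.injOn g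
  rw [image_glTortoise_Ioi, integrableOn_univ] at h
  rw [h]
  refine integrableOn_congr_fun (fun x hx => ?_) measurableSet_Ioi
  have hx1 : (1 : ℝ) < x := hx
  rw [smul_eq_mul, abs_of_pos (div_pos (by linarith) (by linarith))]

/-! ## The potential in the tortoise variable -/

/-- The Gregory–Laflamme potential as a function of `x_*`: `W = V ∘ X`. [cite: Collingbourne2021, §4.1 eq. (pot)] -/
def glPotentialTortoise (ω s : ℝ) : ℝ := glPotential ω (glTortoiseInv s)

/-- `V` is smooth on the exterior `x > 1` (a rational function with nonvanishing denominators).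
[folklore] -/
theorem contDiffOn_glPotential (ω : ℝ) {n : WithTop ℕ∞} : ContDiffOn ℝ n (glPotential ω) (Ioi 1) := by
  have h : ∀ x ∈ Ioi (1 : ℝ), x ≠ 0 ∧ x ^ 4 ≠ 0 ∧ x ^ 4 * (1 + ω ^ 2 * x ^ 3) ^ 2 ≠ 0 ∧
      x ^ 4 * (1 + ω ^ 2 * x ^ 3) ≠ 0 := fun x hx => by
    have hx0 : (0 : ℝ) < x := lt_trans zero_lt_one hx
    exact ⟨by positivity, by positivity, by positivity, by positivity⟩
  unfold glPotential
  refine ((ContDiffOn.add (ContDiffOn.add ?_ ?_) ?_).sub ?_)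
  · exact ContDiffOn.div (by fun_prop) contDiffOn_id fun x hx => (h x hx).1
  · exact ContDiffOn.div (by fun_prop) (by fun_prop) fun x hx => (h x hx).2.1
  · exact ContDiffOn.div (by fun_prop) (by fun_prop) fun x hx => (h x hx).2.2.1
  · exact ContDiffOn.div (by fun_prop) (by fun_prop) fun x hx => (h x hx).2.2.2

/-- `V` is continuous on `x > 1`. [folklore] -/
theorem continuousOn_glPotential (ω : ℝ) : ContinuousOn (glPotential ω) (Ioi 1) :=
  (contDiffOn_glPotential ω (n := 0)).continuousOn

/-- `W = V ∘ X` is continuous on `ℝ`. [folklore] -/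
theorem continuous_glPotentialTortoise (ω : ℝ) : Continuous (glPotentialTortoise ω) :=
  (continuousOn_glPotential ω).comp_continuous continuous_glTortoiseInv one_lt_glTortoiseInv

/-- `|W| ≤ ω̂² + 89`. [folklore] -/
theorem abs_glPotentialTortoise_le (ω s : ℝ) : |glPotentialTortoise ω s| ≤ ω ^ 2 + 89 :=
  abs_glPotential_le ω (one_lt_glTortoiseInv s)

/-- **Asymptotic positivity of `W - E'` for `E' < 0`**: `W s - E' ≥ -E'/2` for `s ≥ T(2 + 142/(-E'))`
(where `V ≥ -71/x² ≥ E'/2`) and for `s ≤ T(1 + (-E'/2)/(ω̂²+89))` (where `|V| ≤ (ω̂²+89)(x-1) ≤ -E'/2`);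
this is "`E₀ < 0` lies below the bottom `min(0, ω̂²) = 0` of the essential spectrum" in elementary
form. [cite: Collingbourne2021, Cor. 4.4] -/
theorem glPotentialTortoise_sub_ge {ω E' : ℝ} (hE' : E' < 0) :
    (∀ s, glTortoise (2 + 142 / (-E')) ≤ s → -E' / 2 ≤ glPotentialTortoise ω s - E') ∧
    (∀ s, s ≤ glTortoise (1 + (-E' / 2) / (ω ^ 2 + 89)) → -E' / 2 ≤ glPotentialTortoise ω s - E') := by
  have hE : 0 < -E' := by linarith
  constructor
  · intro s hs
    set x := glTortoiseInv s with hxdef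
    have hx1 : 1 < x := one_lt_glTortoiseInv s
    have hx : 2 + 142 / (-E') ≤ x :=
      le_glTortoiseInv_of_glTortoise_le (by have := div_pos (by norm_num : (0:ℝ) < 142) hE; linarith) hs
    have hV := glPotential_ge ω hx1
    have hx2 : 142 / (-E') ≤ x ^ 2 := by nlinarith
    have h71 : 71 / x ^ 2 ≤ 71 / (142 / (-E')) :=
      div_le_div_of_nonneg_left (by norm_num) (by positivity) hx2
    have : 71 / (142 / (-E')) = -E' / 2 := by field_simp; ring
    show -E' / 2 ≤ glPotential ω x - E'
    linarith
  · intro s hs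
    set x := glTortoiseInv s with hxdef
    have hx1 : 1 < x := one_lt_glTortoiseInv s
    have hω : 0 < ω ^ 2 + 89 := by positivity
    have hx : x ≤ 1 + (-E' / 2) / (ω ^ 2 + 89) :=
      glTortoiseInv_le_of_le_glTortoise (by have := div_pos (half_pos hE) hω; linarith) hs
    have hV := abs_glPotential_le_mul ω hx1
    have h1 : (ω ^ 2 + 89) * (x - 1) ≤ -E' / 2 := by
      have : x - 1 ≤ (-E' / 2) / (ω ^ 2 + 89) := by linarith
      calc (ω ^ 2 + 89) * (x - 1) ≤ (ω ^ 2 + 89) * ((-E' / 2) / (ω ^ 2 + 89)) :=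
            mul_le_mul_of_nonneg_left this hω.le
        _ = -E' / 2 := by field_simp
    have := neg_abs_le (glPotential ω x)
    show -E' / 2 ≤ glPotential ω x - E'
    linarith

/-! ## Transport of test functions to the tortoise variable -/

section Transport

variable {ψ : ℝ → ℝ}

/-- A `C¹` function on the exterior becomes a `C¹` function of `x_* ∈ ℝ`. [folklore] -/
theorem contDiff_comp_glTortoiseInv (hψ : ContDiffOn ℝ 1 ψ (Ioi 1)) : ContDiff ℝ 1 (ψ ∘ glTortoiseInv) :=
  hψ.comp_contDiff contDiff_glTortoiseInv one_lt_glTortoiseInv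

/-- Chain rule: `d/dx_* (ψ ∘ X) = ψ'(X) · (X - 1)/X`. [cite: Collingbourne2021, §4.3 p. 20] -/
theorem hasDerivAt_comp_glTortoiseInv (hψ : ContDiffOn ℝ 1 ψ (Ioi 1)) (s : ℝ) :
    HasDerivAt (ψ ∘ glTortoiseInv)
      (deriv ψ (glTortoiseInv s) * ((glTortoiseInv s - 1) / glTortoiseInv s)) s := by
  have hd : DifferentiableAt ℝ ψ (glTortoiseInv s) :=
    (hψ.differentiableOn one_ne_zero).differentiableAt (isOpen_Ioi.mem_nhds (one_lt_glTortoiseInv s))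
  exact hd.hasDerivAt.comp s (hasDerivAt_glTortoiseInv s)

/-- At `s = T x`: `(ψ ∘ X)'(T x) = ((x-1)/x) ψ'(x)`. [folklore] -/
theorem deriv_comp_glTortoiseInv_glTortoise (hψ : ContDiffOn ℝ 1 ψ (Ioi 1)) {x : ℝ} (hx : 1 < x) :
    deriv (ψ ∘ glTortoiseInv) (glTortoise x) = (x - 1) / x * deriv ψ x := by
  rw [(hasDerivAt_comp_glTortoiseInv hψ (glTortoise x)).deriv, glTortoiseInv_glTortoise hx, mul_comm]

/-- The `H¹` density transforms to `φ'² + φ²`: for `x > 1`,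
`(x/(x-1)) · ((ψ∘X)'(T x)² + (ψ∘X)(T x)²) = glH1Density ψ x`. [cite: Collingbourne2021, §4.3 p. 20] -/
theorem glH1Density_eq (hψ : ContDiffOn ℝ 1 ψ (Ioi 1)) {x : ℝ} (hx : 1 < x) :
    x / (x - 1) * (deriv (ψ ∘ glTortoiseInv) (glTortoise x) ^ 2 + (ψ ∘ glTortoiseInv) (glTortoise x) ^ 2) =
      glH1Density ψ x := by
  rw [deriv_comp_glTortoiseInv_glTortoise hψ hx, Function.comp_apply, glTortoiseInv_glTortoise hx, glH1Density]
  ring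

/-- The energy density transforms to `φ'² + W φ²`. [cite: Collingbourne2021, §4.3 p. 21] -/
theorem glEnergyDensity_eq (ω : ℝ) (hψ : ContDiffOn ℝ 1 ψ (Ioi 1)) {x : ℝ} (hx : 1 < x) :
    x / (x - 1) * (deriv (ψ ∘ glTortoiseInv) (glTortoise x) ^ 2 +
      glPotentialTortoise ω (glTortoise x) * (ψ ∘ glTortoiseInv) (glTortoise x) ^ 2) =
      glEnergyDensity ω ψ x := by
  rw [deriv_comp_glTortoiseInv_glTortoise hψ hx, Function.comp_apply, glPotentialTortoise,
    glTortoiseInv_glTortoise hx, glEnergyDensity]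
  ring

/-- The `L²` density transforms to `φ²`. [cite: Collingbourne2021, §4.3 p. 20] -/
theorem glL2Density_eq {x : ℝ} (hx : 1 < x) :
    x / (x - 1) * (ψ ∘ glTortoiseInv) (glTortoise x) ^ 2 = ψ x ^ 2 * (x / (x - 1)) := by
  rw [Function.comp_apply, glTortoiseInv_glTortoise hx, mul_comm]

/-- Finite `H¹(ℝ)`-norm in the sense of `HasFiniteGLH1Norm` is integrability of `φ'² + φ²` on `ℝ`
for `φ = ψ ∘ X`. [cite: Collingbourne2021, §4.3 p. 20] -/
theorem integrable_h1_of_hasFiniteGLH1Norm (hψ : ContDiffOn ℝ 1 ψ (Ioi 1)) (h : HasFiniteGLH1Norm ψ) :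
    Integrable (fun s => deriv (ψ ∘ glTortoiseInv) s ^ 2 + (ψ ∘ glTortoiseInv) s ^ 2) := by
  rw [integrable_iff_comp_glTortoise]
  have h' : IntegrableOn (glH1Density ψ) (Ioi 1) := h
  exact h'.congr_fun (fun x hx => (glH1Density_eq hψ hx).symm) measurableSet_Ioi

end Transport

/-! ## The discharge -/

/-- The `C^∞` bootstrap for (ODEF) in the `x`-variable: a function which is differentiable on
`(1, ∞)` together with its derivative, and whose second derivative is given there by the equation
`u'' = x²/(x-1)² (V - E) u - u'/(x(x-1))`, is smooth on `(1, ∞)` (Collingbourne Thm. 8.3: "in this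
paper, only the one-dimensional case of this is applied, which is completely elementary").
[cite: Collingbourne2021, Thm. 8.3] -/
theorem contDiffOn_of_glSchrodinger {ω E : ℝ} {u : ℝ → ℝ} (hd : DifferentiableOn ℝ u (Ioi 1))
    (hd' : DifferentiableOn ℝ (deriv u) (Ioi 1))
    (hode : ∀ x ∈ Ioi (1 : ℝ), deriv (deriv u) x =
      x ^ 2 / (x - 1) ^ 2 * (glPotential ω x - E) * u x - deriv u x / (x * (x - 1))) :
    ContDiffOn ℝ ((⊤ : ℕ∞) : WithTop ℕ∞) u (Ioi 1) := by
  -- the coefficient functions are smooth on `(1, ∞)`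
  have hc1 : ∀ n : WithTop ℕ∞, ContDiffOn ℝ n (fun x : ℝ => x ^ 2 / (x - 1) ^ 2 * (glPotential ω x - E)) (Ioi 1) :=
    fun n => (ContDiffOn.div (by fun_prop) (by fun_prop) fun x hx => by
      have : (1 : ℝ) < x := hx; positivity).mul ((contDiffOn_glPotential ω).sub contDiffOn_const)
  have hc2 : ∀ n : WithTop ℕ∞, ContDiffOn ℝ n (fun x : ℝ => 1 / (x * (x - 1))) (Ioi 1) :=
    fun n => ContDiffOn.div contDiffOn_const (by fun_prop) fun x hx => by
      have h1 : (1 : ℝ) < x := hx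
      have : (0 : ℝ) < x := by linarith
      have : (0 : ℝ) < x - 1 := by linarith
      positivity
  have key : ∀ n : ℕ, ContDiffOn ℝ n u (Ioi 1) ∧ ContDiffOn ℝ n (deriv u) (Ioi 1) := by
    intro n
    induction n with
    | zero =>
      exact ⟨contDiffOn_zero.2 hd.continuousOn, contDiffOn_zero.2 hd'.continuousOn⟩
    | succ n ih =>
      have han : ((n : ℕ∞) : WithTop ℕ∞) = ⊤ → AnalyticOn ℝ u (Ioi 1) := fun h =>
        absurd h (WithTop.natCast_ne_top n)
      have han' : ((n : ℕ∞) : WithTop ℕ∞) = ⊤ → AnalyticOn ℝ (deriv u) (Ioi 1) := fun h =>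
        absurd h (WithTop.natCast_ne_top n)
      refine ⟨?_, ?_⟩
      · rw [Nat.cast_succ]
        exact (contDiffOn_succ_iff_deriv_of_isOpen isOpen_Ioi).2 ⟨hd, han, ih.2⟩
      · rw [Nat.cast_succ]
        refine (contDiffOn_succ_iff_deriv_of_isOpen isOpen_Ioi).2 ⟨hd', han', ?_⟩
        have hrhs : ContDiffOn ℝ n (fun x => x ^ 2 / (x - 1) ^ 2 * (glPotential ω x - E) * u x -
            deriv u x / (x * (x - 1))) (Ioi 1) := by
          refine ((hc1 n).mul ih.1).sub ?_
          have := ih.2.mul (hc2 n)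
          exact this.congr fun x _ => by ring
        exact hrhs.congr fun x hx => hode x hx
  exact contDiffOn_infty.2 fun n => (key n).1

/-- **Collingbourne's variational principle (`GregoryLaflammeNegativeEigenfunction`), proved.**
For `ω̂ ≠ 0`, `E' < 0` and a `C¹` test function `ψ` on `(1, ∞)` of finite `H¹(ℝ)`-norm with
`E(ψ) < E' ‖ψ‖²_{L²(ℝ)}` (densities of pp. 20–21), there are `E ≤ E'` and a smooth solution
`u ≢ 0` of (ODEF) with spectral parameter `E` and finite `H¹(ℝ)`-norm. Proof: pass to
`x_* ∈ ℝ`, apply `Literature.Analysis.ODE.exists_boundState_of_rayleigh` to `W = V ∘ X`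
(bounded, continuous, `W - E' ≥ -E'/2 > 0` near both ends), and transport the positive `H¹`
eigenfunction back to `x`. [cite: Collingbourne2021, Prop. 4.3, Cor. 4.4 and proof of Prop. 4.6] -/
theorem GregoryLaflammeNegativeEigenfunction_holds : GregoryLaflammeNegativeEigenfunction := by
  intro ω E' _hω hE' hyp
  obtain ⟨ψ, hψ, hH1, -, hlt⟩ := hyp
  -- the data in the tortoise variable
  set φ : ℝ → ℝ := ψ ∘ glTortoiseInv with hφdef
  set W : ℝ → ℝ := glPotentialTortoise ω with hWdef
  have hφ : ContDiff ℝ 1 φ := contDiff_comp_glTortoiseInv hψ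
  have hφc : Continuous φ := hφ.continuous
  have hφ'c : Continuous (deriv φ) := hφ.continuous_deriv le_rfl
  have hH1s : Integrable (fun s => deriv φ s ^ 2 + φ s ^ 2) := integrable_h1_of_hasFiniteGLH1Norm hψ hH1
  have hL2 : Integrable (fun s => φ s ^ 2) := by
    refine hH1s.mono (by fun_prop) (ae_of_all _ fun s => ?_)
    rw [Real.norm_eq_abs, Real.norm_eq_abs, abs_of_nonneg (sq_nonneg _),
      abs_of_nonneg (by positivity)]
    nlinarith [sq_nonneg (deriv φ s)]
  have hL2' : Integrable (fun s => deriv φ s ^ 2) := by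
    refine hH1s.mono (by fun_prop) (ae_of_all _ fun s => ?_)
    rw [Real.norm_eq_abs, Real.norm_eq_abs, abs_of_nonneg (sq_nonneg _),
      abs_of_nonneg (by positivity)]
    nlinarith [sq_nonneg (φ s)]
  have hlt_s : ∫ s, (deriv φ s ^ 2 + W s * φ s ^ 2) < E' * ∫ s, φ s ^ 2 := by
    have h1 : ∫ s, (deriv φ s ^ 2 + W s * φ s ^ 2) = ∫ x in Ioi 1, glEnergyDensity ω ψ x := by
      rw [integral_comp_glTortoise]
      exact setIntegral_congr_fun measurableSet_Ioi fun x hx => glEnergyDensity_eq ω hψ hx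
    have h2 : ∫ s, φ s ^ 2 = ∫ x in Ioi 1, ψ x ^ 2 * (x / (x - 1)) := by
      rw [integral_comp_glTortoise]
      exact setIntegral_congr_fun measurableSet_Ioi fun x hx => glL2Density_eq hx
    rw [h1, h2]
    exact hlt
  -- the bound state in the tortoise variable
  have hE : 0 < -E' := by linarith
  obtain ⟨hSp, hSm⟩ := glPotentialTortoise_sub_ge (ω := ω) hE'
  have hc : 0 < min (-E' / 2) 1 := lt_min (by linarith) zero_lt_one
  obtain ⟨E, hEle, v, hv, hvpos, hvL2, hvL2'⟩ := exists_boundState_of_rayleigh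
    (continuous_glPotentialTortoise ω) (abs_glPotentialTortoise_le ω) (E' := E')
    (c := min (-E' / 2) 1) hc (min_le_right _ _)
    (fun s hs => (min_le_left _ _).trans (hSp s hs)) (fun s hs => (min_le_left _ _).trans (hSm s hs))
    hφ hL2 hL2' hlt_s
  -- transport back to `x`
  set u : ℝ → ℝ := fun x => v (glTortoise x) with hudef
  have hWE : ∀ x, 1 < x → W (glTortoise x) - E = glPotential ω x - E := fun x hx => by
    simp only [hWdef, glPotentialTortoise, glTortoiseInv_glTortoise hx]
  -- first derivative on `(1, ∞)`
  have hd1 : ∀ x, 1 < x → HasDerivAt u (deriv v (glTortoise x) * (x / (x - 1))) x := fun x hx =>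
    (hv.hasDerivAt (glTortoise x)).comp x (hasDerivAt_glTortoise hx)
  have hderiv1 : ∀ x, 1 < x → deriv u x = deriv v (glTortoise x) * (x / (x - 1)) := fun x hx =>
    (hd1 x hx).deriv
  -- second derivative on `(1, ∞)`
  have hd2 : ∀ x, 1 < x → HasDerivAt (deriv u)
      ((glPotential ω x - E) * u x * (x / (x - 1)) * (x / (x - 1)) +
        deriv v (glTortoise x) * (-1 / (x - 1) ^ 2)) x := by
    intro x hx
    have hx1 : x - 1 ≠ 0 := by linarith
    have hA : HasDerivAt (fun y => deriv v (glTortoise y)) ((glPotential ω x - E) * u x * (x / (x - 1))) x := by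
      have h := (hv.hasDerivAt_deriv (glTortoise x)).comp x (hasDerivAt_glTortoise hx)
      rw [hWE x hx] at h
      exact h
    have hB : HasDerivAt (fun y : ℝ => y / (y - 1)) (-1 / (x - 1) ^ 2) x := by
      have h := (hasDerivAt_id' x).div ((hasDerivAt_id' x).sub_const 1) hx1
      refine h.congr_deriv ?_
      field_simp
      ring
    have hprod := hA.mul hB
    have heq : deriv u =ᶠ[𝓝 x] fun y => deriv v (glTortoise y) * (y / (y - 1)) := by
      filter_upwards [isOpen_Ioi.mem_nhds hx] with y hy
      exact hderiv1 y hy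
    refine (hprod.congr_of_eventuallyEq heq).congr_deriv ?_
    ring
  have hderiv2 : ∀ x ∈ Ioi (1 : ℝ), deriv (deriv u) x =
      x ^ 2 / (x - 1) ^ 2 * (glPotential ω x - E) * u x - deriv u x / (x * (x - 1)) := by
    intro x hx
    have hx1 : (1 : ℝ) < x := hx
    have hx0 : x ≠ 0 := by linarith
    have hx1' : x - 1 ≠ 0 := by linarith
    rw [(hd2 x hx1).deriv, hderiv1 x hx1]
    field_simp
    ring
  refine ⟨E, hEle, u, ⟨?_, fun x hx => ?_⟩, ⟨2, by norm_num, (hvpos _).ne'⟩, ?_⟩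
  · -- smoothness
    exact contDiffOn_of_glSchrodinger (ω := ω) (E := E)
      (fun x hx => (hd1 x hx).differentiableAt.differentiableWithinAt)
      (fun x hx => (hd2 x hx).differentiableAt.differentiableWithinAt) hderiv2
  · -- the equation (ODEF) in the `x`-variable
    have hx1 : (1 : ℝ) < x := hx
    have hx0 : x ≠ 0 := by linarith
    have hx1' : x - 1 ≠ 0 := by linarith
    rw [hderiv2 x hx]
    field_simp
    ring
  · -- finite `H¹(ℝ)`-norm
    show IntegrableOn (glH1Density u) (Ioi 1)
    have hI : Integrable (fun s => deriv v s ^ 2 + v s ^ 2) := hvL2'.add hvL2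
    rw [integrable_iff_comp_glTortoise] at hI
    refine hI.congr_fun (fun x hx => ?_) measurableSet_Ioi
    have hx1 : (1 : ℝ) < x := hx
    have hx0 : x ≠ 0 := by linarith
    have hx1' : x - 1 ≠ 0 := by linarith
    rw [glH1Density, hderiv1 x hx1]
    simp only [hudef]
    field_simp

/-- **The Gregory–Laflamme instability barrier, discharged** (`GregoryLaflammeInstability`):
for every `3/10 ≤ |ω̂| ≤ 8/10` there are `μ̂ > 1/(20√10)` and a smooth solution `𝔥 ≢ 0` of the
radial mode ODE (HZX) on `(1, ∞)` with `𝔥/w` of finite `H¹(ℝ)`-norm — Collingbourne's Theorem 1.1 /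
Prop. 4.1 in the reduced form recorded by the barrier file, now an unconditional theorem: Prop. 4.5
(`GregoryLaflammeTestEnergyBound_holds`) + the variational principle
(`GregoryLaflammeNegativeEigenfunction_holds`) + the reduction `GregoryLaflammeInstability_of`.
[cite: Collingbourne2021, Thm. 1.1, Prop. 4.1 and Prop. 4.6] -/
theorem GregoryLaflammeInstability_holds : GregoryLaflammeInstability :=
  GregoryLaflammeInstability_of_negativeEigenfunction GregoryLaflammeNegativeEigenfunction_holds

end Literature.Barriers.FinalStateConjecture
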